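import Literature.AlgebraicGeometry.HodgeTheory.KaehlerEmbeddingCurrents
import Literature.Analysis.Complex.PositiveForms
import Literature.Analysis.Complex.PositiveFormsManifold
import HarnessLib

/-!
# The strongly positive cone of real `2p`-covectors: positivity on complex frames and comparison
# with Demailly's strongly positive cone

Topic `Literature/AlgebraicGeometry/HodgeTheory`; lane `lit-hodgefound` (Track 2 foundations library),
prover seat `lit-hodgefound-p06`, self-claimed row g24-#2 of
`run/shared/lean/pub/lit-hodgefound/SKELETON.md`. A bridge between two files of the tree:

* `Literature/AlgebraicGeometry/HodgeTheory/KaehlerEmbeddingCurrents.lean` declares the pointwise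
  **strongly positive cone** `stronglyPositiveCone E p` of REAL `2p`-covectors on a complex normed
  space `E` — the `ℝ≥0`-span of the pull-backs `L^* K_p` of the normalised Kähler power
  `K_p = ω₀^p/p!` of `ℂᵖ` (`Literature.Geometry.Kaehler.kaehlerPow`) along `ℂ`-linear maps
  `L : E → ℂᵖ` (Harvey–Knapp (1974), §1; Lawson, PSPM 27 (1975), p. 203) — with "no theorem about
  these notions beyond unfolding lemmas";
* `Literature/Analysis/Complex/PositiveForms.lean` formalises Demailly, Ch. III §1.A: positive
  forms `IsPositive p u` (Criterion 1.6: `u(v₁, I v₁, …, v_p, I v_p) ≥ 0`), the elementary strongly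
  positive forms `elemProd p α = i α₁∧ᾱ₁∧…∧i α_p∧ᾱ_p` and their `ℝ≥0`-span `IsStronglyPositive`,
  for COMPLEX-valued forms.

Here we prove that the two cones agree on real forms and that the real cone consists of positive
forms:

* `kaehlerPow_apply_complexFrame_eq_normSq_det` — **`K_p(w₁, I w₁, …, w_p, I w_p) = |det w|²`** on
  `ℂᵖ` for every `p`-tuple `w` (`= 1` on unitary frames, `kaehlerPow_complexFrame`; a top-degree form
  transforms by `|det|²` under a complex change of frame, Demailly p. 129
  "`τ(w) = |det(∂w_j/∂z_k)|² τ(z)`", `apply_complexFrame_eq_normSq_det_mul`);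
* `apply_complexFrame_nonneg_of_mem_stronglyPositiveCone`, `isPositive_of_mem_stronglyPositiveCone`,
  `IsPositiveForm.apply_complexFrame_nonneg` — **strongly positive real covectors are `≥ 0` on every
  complex frame** (Harvey–Knapp §1: "The value of a positive `(p,p)`-form on a positive `2p`-vector is
  nonnegative"; Demailly, Example III.1.2 "strongly positive forms are positive");
* `ofRealForm'_kaehlerPow_eq` — **`K_p = 2^{-p} · i dz₁∧dz̄₁∧…∧i dz_p∧dz̄_p`** on `ℂᵖ` (Demailly p. 129:
  `τ(z) = i dz₁∧dz̄₁∧…∧i dz_n∧dz̄_n = 2ⁿ dx₁∧dy₁∧…∧dx_n∧dy_n`), hence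
  `ofRealForm'_kaehlerPow_compContinuousLinearMap` (`L^*K_p = 2^{-p} i β₁∧β̄₁∧…`, `β_j = z_j ∘ L`) and
  `reForm_elemProd_eq` (`Re(i α₁∧ᾱ₁∧…) = 2^p · L^* K_p`, `L = (α₁, …, α_p)`);
* **`mem_stronglyPositiveCone_iff_isStronglyPositive`** — a real `2p`-covector lies in
  `stronglyPositiveCone E p` iff, seen with complex values, it is strongly positive in Demailly's
  sense (`isStronglyPositive_of_mem_stronglyPositiveCone`, `reForm_mem_stronglyPositiveCone`).

All proved; the only definitions are the abbreviations `ofRealForm' u = ofReal ∘ u` and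
`reForm u = Re ∘ u` (the pointwise operations of the tree's `MForm.ofReal` / real part); no named fact.
The identification `Literature.Geometry.Kaehler.complexFrame = PositiveForm.complexFrame` on inner
product spaces is `rfl` (`complexFrame_eq`).

Rider (§ "Manifold level", appended): with `Analysis/Complex/PositiveFormsManifold.lean`, **a real
`2p`-form which is positive in the sense of `KaehlerEmbeddingCurrents.IsPositiveForm` (values in the
strongly positive cone) has a complexification `α ⊗ 1` which is a positive `(p,p)`-form in Demailly's
sense of the summit's `PositiveCurrents` file** (`IsPositiveForm.isPositiveForm_ofReal`), with
strongly positive values (`IsPositiveForm.isStronglyPositive_valueAt_ofReal`) and type `(p,p)`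
(`IsPositiveForm.isOfType_ofReal`; `isOfType_of_forall_isOfTypeAt_valueAt`).

## References

* [HarveyKnapp1974] R. Harvey, A. W. Knapp, *Positive (p,p) forms, Wirtinger's inequality, and
  currents*, in: Value distribution theory, Part A (1974), 43–62, §1.
* [DemaillyAGBook] J.-P. Demailly, *Complex Analytic and Differential Geometry* (version of June 21,
  2012), Ch. III §1.A, p. 129, Def. 1.1, Example 1.2, Criterion 1.6, Prop. 1.12.
* [Lawson1975MinimalVarieties] H. B. Lawson, Jr., *Minimal varieties*, PSPM 27 (1975), §5 p. 203.
-/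

noncomputable section

open scoped ComplexOrder ComplexConjugate NNReal Manifold
open Complex Function Module ContinuousAlternatingMap
open Literature.Geometry.Kaehler (kaehlerPow kaehlerPow_complexFrame)
open Literature.Analysis.Complex (oneForm₀)
open Literature.Analysis.Complex.PositiveForm

namespace Literature.AlgebraicGeometry.HodgeTheory

variable {E : Type*} [NormedAddCommGroup E] [NormedSpace ℂ E] {p : ℕ}

/-- The tree's two complex frames agree: `Literature.Geometry.Kaehler.complexFrame` (inner product
spaces) and `Literature.Analysis.Complex.PositiveForm.complexFrame` (complex normed spaces) are the
same tuple `(u₀, I u₀, u₁, I u₁, …)`. [cite: DemaillyAGBook, Ch. III §1.A p. 129] -/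
theorem complexFrame_eq {T : Type*} [NormedAddCommGroup T] [InnerProductSpace ℂ T] (u : Fin p → T) :
    Literature.Geometry.Kaehler.complexFrame u = complexFrame u := rfl

/-- The real form `u` seen with complex values, `x ↦ (u x : ℂ)`. [cite: DemaillyAGBook, Ch. III Cor. 1.5] -/
abbrev ofRealForm' {k : ℕ} (u : E [⋀^Fin k]→L[ℝ] ℝ) : E [⋀^Fin k]→L[ℝ] ℂ :=
  Complex.ofRealCLM.compContinuousAlternatingMap u

/-- `ofRealForm' u v = ↑(u v)`. [cite: DemaillyAGBook, Ch. III Cor. 1.5] -/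
@[simp] theorem ofRealForm'_apply {k : ℕ} (u : E [⋀^Fin k]→L[ℝ] ℝ) (v : Fin k → E) :
    ofRealForm' u v = (u v : ℂ) := rfl

/-! ### The Kähler volume form of `ℂᵖ` on complex frames -/

/-- **`K_p(w₁, I w₁, …, w_p, I w_p) = |det(w)|²` on `ℂᵖ`** for the normalised Kähler power
`K_p = ω₀^p/p!` of the Euclidean space `ℂᵖ` (`kaehlerPow`) and ANY `p`-tuple `w` (determinant in the
standard unitary basis): `K_p = 1` on the standard complex frame (`kaehlerPow_complexFrame`) and a
top-degree form transforms by `|det|²` under a complex change of frame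
(`apply_complexFrame_eq_normSq_det_mul`; Demailly p. 129 "`τ(w) = |det(∂w_j/∂z_k)|² τ(z)`", and
Harvey–Knapp's Wirtinger normalisation). [cite: DemaillyAGBook, Ch. III §1.A p. 129] [cite: HarveyKnapp1974, §1] -/
theorem kaehlerPow_apply_complexFrame_eq_normSq_det (w : Fin p → EuclideanSpace ℂ (Fin p)) :
    kaehlerPow p (complexFrame w) =
      Complex.normSq ((EuclideanSpace.basisFun (Fin p) ℂ).toBasis.det w) := by
  have key := apply_complexFrame_eq_normSq_det_mul (EuclideanSpace.basisFun (Fin p) ℂ).toBasis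
    (ofRealForm' (kaehlerPow (V := EuclideanSpace ℂ (Fin p)) p)) w
  rw [ofRealForm'_apply, ofRealForm'_apply, OrthonormalBasis.coe_toBasis,
    ← complexFrame_eq (⇑(EuclideanSpace.basisFun (Fin p) ℂ)),
    kaehlerPow_complexFrame p _ (EuclideanSpace.basisFun (Fin p) ℂ).orthonormal, Complex.ofReal_one,
    mul_one] at key
  exact_mod_cast key

/-- **The generators `L^* K_p` of the strongly positive cone are non-negative on every complex frame**:
`(L^*K_p)(v₁, I v₁, …) = |det(L v)|² ≥ 0`. [cite: HarveyKnapp1974, §1] [cite: DemaillyAGBook, Ch. III Example 1.2] -/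
theorem kaehlerPow_compContinuousLinearMap_apply_complexFrame (L : E →L[ℂ] EuclideanSpace ℂ (Fin p))
    (v : Fin p → E) :
    (kaehlerPow (V := EuclideanSpace ℂ (Fin p)) p).compContinuousLinearMap (L.restrictScalars ℝ)
        (complexFrame v) =
      Complex.normSq ((EuclideanSpace.basisFun (Fin p) ℂ).toBasis.det (⇑L ∘ v)) := by
  rw [compContinuousLinearMap_apply, ContinuousLinearMap.coe_restrictScalars', ← map_complexFrame_clm,
    kaehlerPow_apply_complexFrame_eq_normSq_det]

/-- **Strongly positive real `2p`-covectors are positive** (Harvey–Knapp (1974), §1; Demailly,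
Example III.1.2 "strongly positive forms are positive"): every member of the tree's
`stronglyPositiveCone E p` (the `ℝ≥0`-span of the `L^* K_p`) is `≥ 0` on every complex frame
`(v₁, I v₁, …, v_p, I v_p)`. [cite: HarveyKnapp1974, §1] [cite: DemaillyAGBook, Ch. III Example 1.2] -/
theorem apply_complexFrame_nonneg_of_mem_stronglyPositiveCone {u : E [⋀^Fin (2 * p)]→L[ℝ] ℝ}
    (hu : u ∈ stronglyPositiveCone E p) (v : Fin p → E) : 0 ≤ u (complexFrame v) := by
  induction hu using Submodule.span_induction with
  | mem x hx =>
    obtain ⟨L, rfl⟩ := hx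
    rw [kaehlerPow_compContinuousLinearMap_apply_complexFrame]
    exact Complex.normSq_nonneg _
  | zero => simp
  | add x y _ _ hx hy => simpa using add_nonneg hx hy
  | smul c x _ hx => rw [ContinuousAlternatingMap.smul_apply]; exact smul_nonneg c.2 hx

/-- In the language of `Literature/Analysis/Complex/PositiveForms.lean`: a strongly positive real
`2p`-covector, seen with complex values, is a POSITIVE form (Criterion III.1.6).
[cite: DemaillyAGBook, Ch. III Example 1.2 and Criterion 1.6] [cite: HarveyKnapp1974, §1] -/
theorem isPositive_of_mem_stronglyPositiveCone {u : E [⋀^Fin (2 * p)]→L[ℝ] ℝ}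
    (hu : u ∈ stronglyPositiveCone E p) : IsPositive p (ofRealForm' u) := fun v ↦ by
  rw [ofRealForm'_apply]
  exact Complex.zero_le_real.2 (apply_complexFrame_nonneg_of_mem_stronglyPositiveCone hu v)

/-- Pointwise consequence for the manifold-level notion: a positive (= pointwise strongly positive)
real `2p`-form is non-negative on every complex frame of every tangent space.
[cite: HarveyKnapp1974, §1] -/
theorem IsPositiveForm.apply_complexFrame_nonneg {M : Type*} [TopologicalSpace M] [ChartedSpace E M]
    {α : Literature.Geometry.Kaehler.MForm 𝓘(ℝ, E) M ℝ (2 * p)} (hα : IsPositiveForm p α) (x : M)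
    (v : Fin p → E) : 0 ≤ (show E [⋀^Fin (2 * p)]→L[ℝ] ℝ from α x) (complexFrame v) :=
  apply_complexFrame_nonneg_of_mem_stronglyPositiveCone (hα x) v

/-! ### Comparison of the two strongly positive cones -/

/-- **On `ℂᵖ`, the Kähler volume form is `2^{-p}` times Demailly's elementary form of the coordinates**:
`K_p = 2^{-p} · i dz₁∧dz̄₁∧…∧i dz_p∧dz̄_p` (both are top-degree forms; compare them on the standard
complex frame: `1` versus `2^p`, Demailly p. 129 "`τ(z) = 2ⁿ dx₁∧dy₁∧…`").
[cite: DemaillyAGBook, Ch. III §1.A p. 129] -/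
theorem ofRealForm'_kaehlerPow_eq :
    ofRealForm' (kaehlerPow (V := EuclideanSpace ℂ (Fin p)) p) =
      ((2 : ℝ) ^ p)⁻¹ • elemProd p (fun j ↦ (EuclideanSpace.proj j : EuclideanSpace ℂ (Fin p) →L[ℂ] ℂ)) := by
  apply Literature.LinearAlgebra.Alternating.eq_of_apply_basis_eq
    (realBasis (EuclideanSpace.basisFun (Fin p) ℂ).toBasis)
  have hdual : ∀ j k : Fin p, (EuclideanSpace.proj j : EuclideanSpace ℂ (Fin p) →L[ℂ] ℂ)
      ((EuclideanSpace.basisFun (Fin p) ℂ).toBasis k) = if j = k then 1 else 0 := fun j k ↦ by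
    rw [OrthonormalBasis.coe_toBasis, EuclideanSpace.basisFun_apply, EuclideanSpace.coe_proj]
    simp only [PiLp.single_apply]
  rw [coe_realBasis, ofRealForm'_apply, ContinuousAlternatingMap.smul_apply,
    elemProd_apply_complexFrame_of_dual p _ _ hdual, OrthonormalBasis.coe_toBasis,
    ← complexFrame_eq (⇑(EuclideanSpace.basisFun (Fin p) ℂ)),
    kaehlerPow_complexFrame p _ (EuclideanSpace.basisFun (Fin p) ℂ).orthonormal, Complex.real_smul]
  push_cast
  rw [inv_mul_cancel₀ (pow_ne_zero _ two_ne_zero)]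

/-- **The generators `L^* K_p`, complexified, are `2^{-p}` times Demailly's elementary forms
`i β₁∧β̄₁∧…∧i β_p∧β̄_p`, `β_j = z_j ∘ L`** (Demailly, proof of Prop. III.1.12).
[cite: DemaillyAGBook, Ch. III Prop. 1.12] [cite: HarveyKnapp1974, §1] -/
theorem ofRealForm'_kaehlerPow_compContinuousLinearMap (L : E →L[ℂ] EuclideanSpace ℂ (Fin p)) :
    ofRealForm' ((kaehlerPow (V := EuclideanSpace ℂ (Fin p)) p).compContinuousLinearMap
        (L.restrictScalars ℝ)) =
      ((2 : ℝ) ^ p)⁻¹ • elemProd p (fun j ↦ (EuclideanSpace.proj j : EuclideanSpace ℂ (Fin p) →L[ℂ] ℂ).comp L) := by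
  rw [← elemProd_compContinuousLinearMap]
  have h : ofRealForm' ((kaehlerPow (V := EuclideanSpace ℂ (Fin p)) p).compContinuousLinearMap
      (L.restrictScalars ℝ)) = (ofRealForm' (kaehlerPow (V := EuclideanSpace ℂ (Fin p)) p)).compContinuousLinearMap
        (L.restrictScalars ℝ) := by
    ext v; rfl
  rw [h, ofRealForm'_kaehlerPow_eq]
  ext v
  simp [compContinuousLinearMap_apply]

/-- **The tree's strongly positive cone lies in Demailly's**: a member of `stronglyPositiveCone E p`
(real `2p`-covectors, Harvey–Knapp generators `L^* K_p`), seen with complex values, is strongly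
positive in the sense of Demailly's Def. III.1.1 (`Literature.Analysis.Complex.PositiveForm.IsStronglyPositive`).
[cite: DemaillyAGBook, Ch. III Def. 1.1] [cite: HarveyKnapp1974, §1] -/
theorem isStronglyPositive_of_mem_stronglyPositiveCone {u : E [⋀^Fin (2 * p)]→L[ℝ] ℝ}
    (hu : u ∈ stronglyPositiveCone E p) : IsStronglyPositive p (ofRealForm' u) := by
  induction hu using Submodule.span_induction with
  | mem x hx =>
    obtain ⟨L, rfl⟩ := hx
    rw [ofRealForm'_kaehlerPow_compContinuousLinearMap]
    exact (isStronglyPositive_elemProd _).smul (by positivity)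
  | zero =>
    have : ofRealForm' (0 : E [⋀^Fin (2 * p)]→L[ℝ] ℝ) = 0 := by ext v; simp
    rw [this]; exact IsStronglyPositive.zero
  | add x y _ _ hx hy =>
    have : ofRealForm' (x + y) = ofRealForm' x + ofRealForm' y := by ext v; simp
    rw [this]; exact hx.add hy
  | smul c x _ hx =>
    have : ofRealForm' (c • x) = (c : ℝ) • ofRealForm' x := by ext v; simp [NNReal.smul_def]
    rw [this]; exact hx.smul c.2

/-- The real part of a complex-valued form. [cite: DemaillyAGBook, Ch. III Cor. 1.5] -/
abbrev reForm {k : ℕ} (u : E [⋀^Fin k]→L[ℝ] ℂ) : E [⋀^Fin k]→L[ℝ] ℝ :=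
  Complex.reCLM.compContinuousAlternatingMap u

/-- `reForm u v = (u v).re`. [cite: DemaillyAGBook, Ch. III Cor. 1.5] -/
@[simp] theorem reForm_apply {k : ℕ} (u : E [⋀^Fin k]→L[ℝ] ℂ) (v : Fin k → E) : reForm u v = (u v).re := rfl

/-- `re ∘ (ofReal ∘ u) = u`. [cite: DemaillyAGBook, Ch. III Cor. 1.5] -/
theorem reForm_ofRealForm' {k : ℕ} (u : E [⋀^Fin k]→L[ℝ] ℝ) : reForm (ofRealForm' u) = u := by
  ext v; simp

/-- **Demailly's elementary forms, restricted to real parts, are `2^p` times Harvey–Knapp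
generators**: `Re(i α₁∧ᾱ₁∧…∧i α_p∧ᾱ_p) = 2^p · L^* K_p` with `L = (α₁, …, α_p) : E → ℂᵖ`.
[cite: DemaillyAGBook, Ch. III Def. 1.1] [cite: HarveyKnapp1974, §1] -/
theorem reForm_elemProd_eq (α : Fin p → (E →L[ℂ] ℂ)) :
    reForm (elemProd p α) = (2 : ℝ) ^ p •
      (kaehlerPow (V := EuclideanSpace ℂ (Fin p)) p).compContinuousLinearMap
        ((((EuclideanSpace.equiv (Fin p) ℂ).symm : (Fin p → ℂ) →L[ℂ] EuclideanSpace ℂ (Fin p)).comp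
          (piMap α)).restrictScalars ℝ) := by
  set L : E →L[ℂ] EuclideanSpace ℂ (Fin p) :=
    ((EuclideanSpace.equiv (Fin p) ℂ).symm : (Fin p → ℂ) →L[ℂ] EuclideanSpace ℂ (Fin p)).comp (piMap α)
    with hL
  have hα : (fun j ↦ (EuclideanSpace.proj j : EuclideanSpace ℂ (Fin p) →L[ℂ] ℂ).comp L) = α := by
    funext j; ext x; rfl
  have key := congr_arg reForm (ofRealForm'_kaehlerPow_compContinuousLinearMap (E := E) L)
  rw [reForm_ofRealForm', hα] at key
  rw [key]
  ext v
  simp only [reForm_apply, ContinuousAlternatingMap.smul_apply, Complex.real_smul, Complex.mul_re,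
    Complex.ofReal_re, Complex.ofReal_im, zero_mul, sub_zero, smul_eq_mul]
  rw [← mul_assoc, mul_inv_cancel₀ (pow_ne_zero _ two_ne_zero), one_mul]

/-- **Conversely, Demailly's strongly positive cone restricts to the tree's**: the real part of a
strongly positive `(p,p)`-form (Def. III.1.1) lies in `stronglyPositiveCone E p`.
[cite: DemaillyAGBook, Ch. III Def. 1.1] [cite: HarveyKnapp1974, §1] -/
theorem reForm_mem_stronglyPositiveCone {u : E [⋀^Fin (2 * p)]→L[ℝ] ℂ} (hu : IsStronglyPositive p u) :
    reForm u ∈ stronglyPositiveCone E p := by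
  induction hu using Submodule.span_induction with
  | mem x hx =>
    obtain ⟨α, rfl⟩ := hx
    rw [reForm_elemProd_eq]
    have hgen : (kaehlerPow (V := EuclideanSpace ℂ (Fin p)) p).compContinuousLinearMap
        ((((EuclideanSpace.equiv (Fin p) ℂ).symm : (Fin p → ℂ) →L[ℂ] EuclideanSpace ℂ (Fin p)).comp
          (piMap α)).restrictScalars ℝ) ∈ stronglyPositiveCone E p :=
      Submodule.subset_span ⟨_, rfl⟩
    have h2 : (⟨(2 : ℝ) ^ p, by positivity⟩ : ℝ≥0) • (kaehlerPow (V := EuclideanSpace ℂ (Fin p)) p).compContinuousLinearMap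
        ((((EuclideanSpace.equiv (Fin p) ℂ).symm : (Fin p → ℂ) →L[ℂ] EuclideanSpace ℂ (Fin p)).comp
          (piMap α)).restrictScalars ℝ) = (2 : ℝ) ^ p • (kaehlerPow (V := EuclideanSpace ℂ (Fin p)) p).compContinuousLinearMap
        ((((EuclideanSpace.equiv (Fin p) ℂ).symm : (Fin p → ℂ) →L[ℂ] EuclideanSpace ℂ (Fin p)).comp
          (piMap α)).restrictScalars ℝ) := NNReal.smul_def _ _
    rw [← h2]
    exact Submodule.smul_mem _ _ hgen
  | zero =>
    have : reForm (0 : E [⋀^Fin (2 * p)]→L[ℝ] ℂ) = 0 := by ext v; simp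
    rw [this]; exact Submodule.zero_mem _
  | add x y _ _ hx hy =>
    have : reForm (x + y) = reForm x + reForm y := by ext v; simp
    rw [this]; exact Submodule.add_mem _ hx hy
  | smul c x _ hx =>
    have : reForm (c • x) = c • reForm x := by ext v; simp [NNReal.smul_def]
    rw [this]; exact Submodule.smul_mem _ c hx

/-- **The two strongly positive cones agree on real forms**: a real `2p`-covector lies in the tree's
`stronglyPositiveCone E p` (Harvey–Knapp: `ℝ≥0`-span of the `L^* K_p`) iff, seen with complex
values, it is strongly positive in Demailly's sense (`ℝ≥0`-span of the `i α₁∧ᾱ₁∧…∧i α_p∧ᾱ_p`).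
[cite: DemaillyAGBook, Ch. III Def. 1.1] [cite: HarveyKnapp1974, §1] -/
theorem mem_stronglyPositiveCone_iff_isStronglyPositive {u : E [⋀^Fin (2 * p)]→L[ℝ] ℝ} :
    u ∈ stronglyPositiveCone E p ↔ IsStronglyPositive p (ofRealForm' u) := by
  refine ⟨isStronglyPositive_of_mem_stronglyPositiveCone, fun h ↦ ?_⟩
  rw [← reForm_ofRealForm' u]
  exact reForm_mem_stronglyPositiveCone h


/-! ### Manifold level (rider): real positive forms complexify to Demailly-positive `(p,p)`-forms -/

section ManifoldLevel

variable {M : Type*} [TopologicalSpace M] [ChartedSpace E M]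

open Literature.NumberTheory.Transcendental (IsOfType)
open Literature.Analysis.Complex (IsOfTypeAt)
open Literature.Geometry.Kaehler (MForm)

/-- A complex `(p+p)`-form whose values (re-indexed as `2p`-forms, `PositiveForm.valueAt`) have
pointwise type `(p,p)` is of type `(p,p)`. [cite: DemaillyAGBook, Ch. III Def. 1.1] -/
theorem isOfType_of_forall_isOfTypeAt_valueAt {φ : MForm 𝓘(ℝ, E) M ℂ (p + p)}
    (h : ∀ x, IsOfTypeAt p p (valueAt φ x)) : IsOfType p p φ :=
  ⟨rfl, fun x θ v ↦ by
    have := (h x).2 θ (show Fin (2 * p) → E from v ∘ Fin.cast (two_mul p))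
    rw [valueAt_apply, valueAt_apply] at this
    exact this⟩

/-- The value of the complexification `α ⊗ 1` (as a `(p+p)`-form) is `ofReal ∘ αₓ`.
[cite: DemaillyAGBook, Ch. III Def. 1.1] -/
theorem valueAt_castDeg_ofReal (α : MForm 𝓘(ℝ, E) M ℝ (2 * p)) (x : M) :
    valueAt ((α.ofReal).castDeg (two_mul p)) x = ofRealForm' (show E [⋀^Fin (2 * p)]→L[ℝ] ℝ from α x) := by
  ext v
  rfl

/-- **The values of a positive real `2p`-form are strongly positive in Demailly's sense** (after
complexification; `mem_stronglyPositiveCone_iff_isStronglyPositive` pointwise).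
[cite: DemaillyAGBook, Ch. III Def. 1.1] [cite: HarveyKnapp1974, §1] -/
theorem IsPositiveForm.isStronglyPositive_valueAt_ofReal {α : MForm 𝓘(ℝ, E) M ℝ (2 * p)}
    (hα : IsPositiveForm p α) (x : M) :
    IsStronglyPositive p (valueAt ((α.ofReal).castDeg (two_mul p)) x) := by
  rw [valueAt_castDeg_ofReal]
  exact mem_stronglyPositiveCone_iff_isStronglyPositive.1 (hα x)

/-- The complexification of a positive real `2p`-form is of type `(p,p)`.
[cite: DemaillyAGBook, Ch. III Def. 1.1 and Cor. 1.5] -/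
theorem IsPositiveForm.isOfType_ofReal {α : MForm 𝓘(ℝ, E) M ℝ (2 * p)} (hα : IsPositiveForm p α) :
    IsOfType p p ((α.ofReal).castDeg (two_mul p)) :=
  isOfType_of_forall_isOfTypeAt_valueAt fun x ↦ (hα.isStronglyPositive_valueAt_ofReal x).isOfTypeAt

/-- **A positive real `2p`-form (values in the strongly positive cone of Harvey–Knapp / Lawson)
complexifies to a positive `(p,p)`-form in Demailly's sense** — the manifold-level notion of the
summit's `PositiveCurrents` file (Def. III.1.1 / Criterion III.1.6): strongly positive ⇒ positive
(Demailly, Example III.1.2 / (1.3)). [cite: DemaillyAGBook, Ch. III Example 1.2] [cite: HarveyKnapp1974, §1] -/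
theorem IsPositiveForm.isPositiveForm_ofReal {α : MForm 𝓘(ℝ, E) M ℝ (2 * p)} (hα : IsPositiveForm p α) :
    Literature.Barriers.HodgeConjecture.IsPositiveForm p ((α.ofReal).castDeg (two_mul p)) :=
  isPositiveForm_of_isStronglyPositive hα.isOfType_ofReal hα.isStronglyPositive_valueAt_ofReal

end ManifoldLevel

end Literature.AlgebraicGeometry.HodgeTheory

end
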